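import Mathlib
import HarnessLib
import Summits.Ventures.LatticeQCDFlow.Exactness.SUNStoutLayerEquivariance
import Summits.Ventures.LatticeQCDFlow.Exactness.EquivariantJacobianGaugeInvariance
import Summits.Ventures.LatticeQCDFlow.Scoring.HMCKernelCenterSymmetry

/-!
# The masked `SU(N)` stout layer commutes with the global CENTRE transformation; its exact Jacobians, model density and flow-sampler weight are centre blind

HONEST FRAMING: exact (Metropolis-corrected) sampling algorithms for lattice gauge theory;
figures of merit are autocorrelation/cost numbers at stated couplings and volumes; no
continuum-physics claim.

Venture `LatticeQCDFlow` (cell pub-lqcd), topic `Exactness`; FANOUT row 10 (`eng-equiv`, engine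
`latflow.equiv` / `latflow.flows_jax`: `residual.py` stout / stout-defect layers
`V(x,μ) ↦ exp(ρ(V,(x,μ)) • P(Ω_{x,μ}(V))) · V(x,μ)` on active links).  NEW WORK of the cell;
nothing is cited as a fact; no number; no definition is introduced.  The centre-symmetry member of
row 10's symmetry series for the stout layer (gauge `SUNStoutLayerEquivariance`, translations
`SUNStoutLayerTranslation`, charge conjugation `SUNStoutLayerChargeConjugation`), on the
Literature's centre transformation (`Barriers/QuantumFields/CenterSymmetryBreakingByQuarks`:
`centerTwist z t₀ = (twistConfig z t₀ * ·)`, `centerTwistEquiv`, `twistConfig_mem_center`,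
`map_centerTwist_pi_haar`, `wilsonAction_centerTwist`) and row 16's
`Scoring.plaquetteLoopSum_centerTwist` (the staple loop sum is centre blind).

## What is typed (every `N`, `d ≥ 1`, `L`, central `z`, slice `t₀`, every mask `p`)

* **`sunStoutLayer_centerTwist`** — with a centre-blind coefficient field on active links
  (`ρ(z·V, e) = ρ(V, e)`: constants, or a conditioner reading traces of contractible closed loops
  — Polyakov lines are NOT centre blind) the layer intertwines the centre transformation:
  `F(z·V) = z·F(V)` (the exponent is centre blind and the twist factor is central, so it slides
  past the stout factor);
* `sunStoutLayer_equiv_centerTwist`; **`ae_centerInvariant_jacobian_sunStoutLayer`** (every exact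
  Jacobian for product Haar, a.e.); **`centerInvariant_jacobian_sunStoutLayer`** (continuous ones
  everywhere); `centerInvariant_modelDensity_sunStoutLayer`;
  `centerInvariant_flowWeight_sunStoutLayer` — the stout flow sampler's importance weight
  `e^{−βS_W}·(J∘Ψ⁻¹)` is centre blind for every representation `ρ_W` of the Wilson action (the
  ACTION is centre blind for every `ρ_W` because plaquettes are) — the input of the sampler-level
  statement (sequel, with `FlowSamplerTranslationCovariance` §1): from the hot start the
  flow-sampler run has `E_t[tr P] = 0` at every step.

NOT here: the `U(1)` / spectral layers (same argument: their kernels act by `h(P)P⁻¹` on a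
centre-blind plaquette `P`, so they commute with the twist verbatim — left to a sequel so this file
stays on built parents); any number.
-/

noncomputable section

namespace Summit.Ventures.LatticeQCDFlow.Exactness

open Matrix MeasureTheory
open Literature.MathematicalPhysics.QuantumFieldTheory
open Literature.Barriers.QuantumFields (twistConfig centerTwist centerTwist_apply twistConfig_mem_center
  centerTwistEquiv centerTwistEquiv_apply map_centerTwist_pi_haar wilsonAction_centerTwist)
open scoped ENNReal

variable {d L n : ℕ} [NeZero d]

/-! ## The layer intertwines the centre transformation -/

section Layer

variable {z : Matrix.specialUnitaryGroup (Fin n) ℂ} (hz : z ∈ Subgroup.center (Matrix.specialUnitaryGroup (Fin n) ℂ))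
  (t₀ : ZMod L)
include hz

/-- **The masked `SU(N)` stout layer commutes with the centre transformation**: for a centre-blind
coefficient field on active links, `F(z·V) = z·F(V)`. -/
theorem sunStoutLayer_centerTwist (p : Edge d L → Prop) [DecidablePred p]
    (ρ : GaugeConfig d L (Matrix.specialUnitaryGroup (Fin n) ℂ) → Edge d L → ℝ)
    (hρz : ∀ (V : GaugeConfig d L (Matrix.specialUnitaryGroup (Fin n) ℂ)) (e : Edge d L), p e →
      ρ (centerTwist z t₀ V) e = ρ V e)
    (V : GaugeConfig d L (Matrix.specialUnitaryGroup (Fin n) ℂ)) :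
    (fun e : Edge d L =>
        if p e then
          (⟨NormedSpace.exp ((ρ (centerTwist z t₀ V) e : ℂ) • suProj (plaquetteLoopSum (centerTwist z t₀ V) e.1 e.2)),
              exp_smul_suProj_mem (ρ (centerTwist z t₀ V) e) (plaquetteLoopSum (centerTwist z t₀ V) e.1 e.2)⟩ :
              Matrix.specialUnitaryGroup (Fin n) ℂ) * centerTwist z t₀ V e
        else centerTwist z t₀ V e) =
      centerTwist z t₀ (fun e : Edge d L =>
        if p e then
          (⟨NormedSpace.exp ((ρ V e : ℂ) • suProj (plaquetteLoopSum V e.1 e.2)),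
              exp_smul_suProj_mem (ρ V e) (plaquetteLoopSum V e.1 e.2)⟩ :
              Matrix.specialUnitaryGroup (Fin n) ℂ) * V e
        else V e) := by
  funext e
  rw [centerTwist_apply, centerTwist_apply]
  by_cases he : p e
  · rw [if_pos he, if_pos he]
    have hc := Subgroup.mem_center_iff.1 (twistConfig_mem_center (d := d) (L := L) hz t₀ e)
    -- the exponent is centre blind; the central twist factor slides past the stout factor
    simp only [hρz V e he, Scoring.plaquetteLoopSum_centerTwist hz t₀]
    rw [show (if e.2 = 0 ∧ e.1 0 = t₀ then z else 1) = twistConfig z t₀ e from rfl, ← mul_assoc, ← mul_assoc, hc]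
  · rw [if_neg he, if_neg he]

end Layer

/-! ## Exact Jacobians, the model density and the flow-sampler weight are centre blind -/

section Jacobian

variable [NeZero L] {z : Matrix.specialUnitaryGroup (Fin n) ℂ}
  (hz : z ∈ Subgroup.center (Matrix.specialUnitaryGroup (Fin n) ℂ)) (t₀ : ZMod L)
  (p : Edge d L → Prop) [DecidablePred p]
  (ρ : GaugeConfig d L (Matrix.specialUnitaryGroup (Fin n) ℂ) → Edge d L → ℝ)
  (hρz : ∀ (V : GaugeConfig d L (Matrix.specialUnitaryGroup (Fin n) ℂ)) (e : Edge d L), p e →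
    ρ (centerTwist z t₀ V) e = ρ V e)
  (Ψ : GaugeConfig d L (Matrix.specialUnitaryGroup (Fin n) ℂ) ≃ᵐ
    GaugeConfig d L (Matrix.specialUnitaryGroup (Fin n) ℂ))
  (hΨ : ⇑Ψ = fun (V : GaugeConfig d L (Matrix.specialUnitaryGroup (Fin n) ℂ)) (e : Edge d L) =>
    if p e then
      (⟨NormedSpace.exp ((ρ V e : ℂ) • suProj (plaquetteLoopSum V e.1 e.2)),
          exp_smul_suProj_mem (ρ V e) (plaquetteLoopSum V e.1 e.2)⟩ :
        Matrix.specialUnitaryGroup (Fin n) ℂ) * V e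
    else V e)

include hz hρz hΨ

omit [NeZero L] in
/-- The layer, presented as a measurable automorphism `Ψ`, commutes with `centerTwistEquiv z t₀`. -/
theorem sunStoutLayer_equiv_centerTwist (V : GaugeConfig d L (Matrix.specialUnitaryGroup (Fin n) ℂ)) :
    Ψ (centerTwistEquiv z t₀ V) = centerTwistEquiv z t₀ (Ψ V) := by
  rw [centerTwistEquiv_apply, centerTwistEquiv_apply, hΨ]
  exact sunStoutLayer_centerTwist hz t₀ p ρ hρz V

/-- **Every exact Jacobian of the masked `SU(N)` stout layer is centre blind almost everywhere**
(product Haar is invariant under the twist — left invariance of Haar, link by link). -/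
theorem ae_centerInvariant_jacobian_sunStoutLayer
    {J : GaugeConfig d L (Matrix.specialUnitaryGroup (Fin n) ℂ) → ℝ≥0∞}
    (h : HasJacobian (Measure.pi fun _ : Edge d L => haarProbability (Matrix.specialUnitaryGroup (Fin n) ℂ)) Ψ J) :
    ∀ᵐ U ∂(Measure.pi fun _ : Edge d L => haarProbability (Matrix.specialUnitaryGroup (Fin n) ℂ)),
      J (centerTwist z t₀ U) = J U := by
  have hae := h.jac_comp_symm_ae_eq (centerTwistEquiv z t₀)
    ⟨(centerTwistEquiv z t₀).measurable, map_centerTwist_pi_haar z t₀⟩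
    (sunStoutLayer_equiv_centerTwist hz t₀ p ρ hρz Ψ hΨ)
  filter_upwards [hae] with U hU
  exact hU

/-- **… and everywhere for a continuous exact Jacobian `j ≥ 0`.** -/
theorem centerInvariant_jacobian_sunStoutLayer
    {j : GaugeConfig d L (Matrix.specialUnitaryGroup (Fin n) ℂ) → ℝ} (hj : Continuous j) (hj0 : ∀ U, 0 ≤ j U)
    (h : HasJacobian (Measure.pi fun _ : Edge d L => haarProbability (Matrix.specialUnitaryGroup (Fin n) ℂ)) Ψ
      (fun U => ENNReal.ofReal (j U)))
    (U : GaugeConfig d L (Matrix.specialUnitaryGroup (Fin n) ℂ)) : j (centerTwist z t₀ U) = j U := by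
  haveI : SecondCountableTopology (Matrix (Fin n) (Fin n) ℂ) :=
    inferInstanceAs (SecondCountableTopology (Fin n → Fin n → ℂ))
  haveI : SecondCountableTopology (Matrix.specialUnitaryGroup (Fin n) ℂ) :=
    Topology.IsEmbedding.subtypeVal.secondCountableTopology
  haveI : (haarProbability (Matrix.specialUnitaryGroup (Fin n) ℂ)).IsOpenPosMeasure := by
    unfold haarProbability; infer_instance
  have hTc : Continuous (centerTwistEquiv (d := d) (L := L) z t₀) := by
    change Continuous fun U : GaugeConfig d L (Matrix.specialUnitaryGroup (Fin n) ℂ) => centerTwist z t₀ U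
    exact continuous_const.mul continuous_id
  have h1 := HasJacobian.jac_comp_symm_eq hj h (centerTwistEquiv z t₀)
    ⟨(centerTwistEquiv z t₀).measurable, map_centerTwist_pi_haar z t₀⟩ hTc
    (sunStoutLayer_equiv_centerTwist hz t₀ p ρ hρz Ψ hΨ) U
  exact (ENNReal.ofReal_eq_ofReal_iff (hj0 _) (hj0 _)).1 h1

/-- **The stout flow's model density is centre blind**: `((r/j) ∘ Ψ⁻¹)(z·U) = ((r/j) ∘ Ψ⁻¹)(U)` for a
centre-blind prior density `r` and a continuous exact Jacobian `j ≥ 0`. -/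
theorem centerInvariant_modelDensity_sunStoutLayer
    {j r : GaugeConfig d L (Matrix.specialUnitaryGroup (Fin n) ℂ) → ℝ} (hj : Continuous j) (hj0 : ∀ U, 0 ≤ j U)
    (h : HasJacobian (Measure.pi fun _ : Edge d L => haarProbability (Matrix.specialUnitaryGroup (Fin n) ℂ)) Ψ
      (fun U => ENNReal.ofReal (j U)))
    (hr : ∀ V : GaugeConfig d L (Matrix.specialUnitaryGroup (Fin n) ℂ), r (centerTwist z t₀ V) = r V)
    (U : GaugeConfig d L (Matrix.specialUnitaryGroup (Fin n) ℂ)) :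
    r (Ψ.symm (centerTwist z t₀ U)) / j (Ψ.symm (centerTwist z t₀ U)) = r (Ψ.symm U) / j (Ψ.symm U) := by
  have hsymm : Ψ.symm (centerTwist z t₀ U) = centerTwist z t₀ (Ψ.symm U) := by
    apply Ψ.injective
    have h2 := sunStoutLayer_equiv_centerTwist hz t₀ p ρ hρz Ψ hΨ (Ψ.symm U)
    rw [centerTwistEquiv_apply, centerTwistEquiv_apply, Ψ.apply_symm_apply] at h2
    rw [Ψ.apply_symm_apply, h2]
  rw [hsymm, hr, centerInvariant_jacobian_sunStoutLayer hz t₀ p ρ hρz Ψ hΨ hj hj0 h (Ψ.symm U)]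

/-- **The stout flow sampler's importance weight `e^{−βS_W}·(J∘Ψ⁻¹)` is centre blind** (every
representation `ρ_W` of the Wilson action — the action only sees plaquettes). -/
theorem centerInvariant_flowWeight_sunStoutLayer {N : ℕ}
    (ρW : Matrix.specialUnitaryGroup (Fin n) ℂ →* Matrix (Fin N) (Fin N) ℂ) (β : ℝ)
    {j : GaugeConfig d L (Matrix.specialUnitaryGroup (Fin n) ℂ) → ℝ} (hj : Continuous j) (hj0 : ∀ U, 0 ≤ j U)
    (h : HasJacobian (Measure.pi fun _ : Edge d L => haarProbability (Matrix.specialUnitaryGroup (Fin n) ℂ)) Ψ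
      (fun U => ENNReal.ofReal (j U)))
    (U : GaugeConfig d L (Matrix.specialUnitaryGroup (Fin n) ℂ)) :
    Real.exp (-β * wilsonAction ρW (centerTwist z t₀ U)) * j (Ψ.symm (centerTwist z t₀ U)) =
      Real.exp (-β * wilsonAction ρW U) * j (Ψ.symm U) := by
  have hsymm : Ψ.symm (centerTwist z t₀ U) = centerTwist z t₀ (Ψ.symm U) := by
    apply Ψ.injective
    have h2 := sunStoutLayer_equiv_centerTwist hz t₀ p ρ hρz Ψ hΨ (Ψ.symm U)
    rw [centerTwistEquiv_apply, centerTwistEquiv_apply, Ψ.apply_symm_apply] at h2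
    rw [Ψ.apply_symm_apply, h2]
  rw [hsymm, centerInvariant_jacobian_sunStoutLayer hz t₀ p ρ hρz Ψ hΨ hj hj0 h (Ψ.symm U),
    wilsonAction_centerTwist ρW hz]

end Jacobian

end Summit.Ventures.LatticeQCDFlow.Exactness

end
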